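/-
Copyright: the b2b-balaban cell (near-miss cell 7), T⁴-continuum fan-out; row NE7b ROUND-2 swarm, seat
t4-ne7b-formalise-leaf-03 (gen 3) (row S12 «ASSEMBLY», sub-row S12e; THE LAST JUNCTION «S12e END v2 × row S6g′'s
INSTANCE», part 2, owner's claim table v3.33 (3)).  Released under the licence of the surrounding project.
-/
import Summits.QuantumFields.BalabanUV.T4Continuum.Support.HistoryJoinsPlacedMult
import Summits.QuantumFields.BalabanUV.T4Continuum.Support.HistoryRealiseDistinctValue
import Summits.QuantumFields.BalabanUV.T4Continuum.Support.HistoryAssemblyMultLetters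
import Summits.QuantumFields.BalabanUV.T4Continuum.Support.HistoryRealiseTimed
import Summits.QuantumFields.BalabanUV.T4Continuum.Support.HistoryCaps

/-!
# History assembly, multiplicity socket: ROW S6g′'s INSTANCE IN THE SOCKET's LETTERS (the last junction, part 2)

Summits-side support leaf of the T⁴-continuum cell (rung (B)+1 on a FINITE torus only; NOT infinite volume, NOT the
mass gap, NOT the Clay statement; NOT a proof of the spine estimate NE7b).  Row NE7b, route «COUNT», sub-row S12e and
the LAST JUNCTION (owner's claim table v3.33 (3); typer diagnostic T-NE7b-14).  [folklore] COMPOSITION BY NAME of row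
S6g′'s instance — leaf-05 gen 4's image count `HistoryJoinsPlacedMult.card_koccOf_le` (T3b-5) and twin END
`HistoryJoinsPlacedTwin.card_S_sortR_le_exp_pow` — with the letters `HistoryAssemblyMultLetters`, for the realised
reading `HistoryRealiseCellsRun.RealisedDomainsR` of the END of record v2; and leaf-08 gen 4's `hdis_of_realisesD`
(row S1c-opt) for the display `hdis`.  No definition, no `[cite:]` tag, nothing printed asserted, no `Prop` fact.

WHAT.
* §1 `fat_root_add_one_le_bsum` (the root is a birth: `fat (root G) + 1 ≤ bsum (fat+1) G`), `tcap_mono`.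
* §2 **`hdis_of_domainsR`** ∕ **`hdisV_of_domainsR`**: T3b's display `hdis` — in the typed letters and in the letters
  of record `(physV …).Nodup` — for EVERY live component, from `RealisedDomainsR` + the two DISPLAYED reading clauses
  `DisjointJoins` ∕ `BoxedBirths` (levels `levelOf (s K) K`) per live component (leaf-08 gen 4), for any template
  capacity `M K` holding the births' classes; `tcap_fat_le_of_mem_pbirths`: the capacity READ OFF THE DATA,
  `M K := tcap d (dcapOf Prod.fst T (memOf …) K)` (leaf-06's class cap), holds them — no capacity display needed.
* §3 **`card_koccOf_le_exp`** — THE INSTANCE IN THE SOCKET's LETTERS: for `K ≥ K₀`, a bad term `τ` and a live `c`,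
  `#koccOf ped liveC (cellOfR n L s ped cellP) (physV …) jhalf T K (kslot (keyOf … K τ c))
     ≤ exp(θ·birthLinT Prod.fst ((ped K τ).genT c) + Ξ K (·, (ped K τ).genT c))·((L:ℝ)^d)^{partnerAges (PEv.step ∘ Prod.fst) ((ped K τ).genT c)}`
  with THE HOMES (T-NE7b-14, LETTERS NOTE journal l.14445, owner «agreed» l.14503):
  - `θ` ≥ **`ΘJ d sS θc + 8·2^d·log(2d+1)`** (the twin END's class-linear constant at collar 32, stride `sS`, decay `θc`,
    plus the slope of the root-template factor `A d M (tcap d (fat root)) ≤ exp(2·log(2d+1)·4·2^d·(fat root + 1))`) —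
    PAID in the kernel by the birth-credit slack `hslack` of the socket END;
  - `Λm := (L:ℝ)^d` (⇒ `Λr := 1` in the socket END) — PAID by the exit's rate condition `hκ₁`;
  - **`Ξ K q := 8 ∕ C.E₂ · totalCostT Prod.fst C K (R K) q.2 + 4·partnerAges (PEv.step ∘ Prod.fst) q.2`** — DISPLAYED: it
    re-enters H3's price sentence as the discount `exp(−Ξ K q)`; its first summand is print's renewal-entropy discount
    READ (cost floor `φ := C.E₂`, `floorK ≥ E₂` since `R ≥ 1`), its second is the count-side surplus `e^4` PER PARTNER-AGE
    UNIT of the twin END DISPLACED into the H3 reading (reading stronger than print at that field — (R1) class; the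
    kernel-paid alternative, a κ₁-largeness with Λ-generic ENDs, changes the END's budget letter `(F.L)^d` and is not
    taken here).
  Inputs: the reading `H : RealisedDomainsR L s n K₀ R T ped cellP liveC Zd` (its fields `renew_step`, `forest`,
  `headOldest`, `real`, `inBox`), the DISPLAYED H3-side clauses `hstep` (components dated no later than the cutoff) and
  `hdis` (bad terms' live components, letters of record), run side conditions `4 ≤ L`, `0 < n`, `13 ≤ C.n₁`, `1 ≤ R`,
  per-run monotone ∕ drop-controlled profile, the constants' signs `0 < C.E₂`, `0 ≤ C.E₃`, and the count-side stride ∕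
  decay parameters `sS`, `θc` with their three arithmetic side conditions (c2: symbolic, no numerals of print).

HONEST SCOPE.  Bookkeeping over OUR carriers; every H3-side item is a HYPOTHESIS; nothing of print asserted; nothing of
H3 ∕ (B) ∕ BetaPertH discharged; `hmult` is discharged in THESE letters only (the END file `HistoryRealiseCellsRunMultEnd`
plugs it); `resum` stays displayed; NE7b NOT proved.  HONEST DEPENDENCY (cell): continuum YM on T⁴ ⇐ BetaPertH ∧ nine
spine estimates (0/9 proved); BetaPertH ⇐ (D1) ∧ (D4) ∧ CAP+tail; G-an2-4 gates asym, D1 and NE2/3/4.  Unchanged here.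
-/

open Finset
open Literature.MathematicalPhysics.QuantumFieldTheory.Balaban1983to89
open Literature.MathematicalPhysics.QuantumFieldTheory.Balaban1983to89.B13ScaleTransfer (Pt FaceConnected)
open Literature.MathematicalPhysics.QuantumFieldTheory.Balaban1983to89.B16SProfile (DropCtl)
open T4PersistenceDictionary T4PrintedShapeBanking T4TaggedShapeBanking T4PartnerMultiplicity T4BranchingRecordsGas
open Summit.QuantumFields.BalabanUV.T4Continuum.ZoneTorus
open Summit.QuantumFields.BalabanUV.T4Continuum.ZoneSkeleton
open Summit.QuantumFields.BalabanUV.T4Continuum.HistoryZones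
open Summit.QuantumFields.BalabanUV.T4Continuum.HistoryZoneEvolve (cth)
open Summit.QuantumFields.BalabanUV.T4Continuum.HistoryAdmissible
open Summit.QuantumFields.BalabanUV.T4Continuum.HistoryRealise
open Summit.QuantumFields.BalabanUV.T4Continuum.HistoryRealiseCells
open Summit.QuantumFields.BalabanUV.T4Continuum.HistoryRealiseCellsRun
open Summit.QuantumFields.BalabanUV.T4Continuum.HistoryRealiseDistinct
open Summit.QuantumFields.BalabanUV.T4Continuum.HistoryGen
open Summit.QuantumFields.BalabanUV.T4Continuum.HistoryJoins
open Summit.QuantumFields.BalabanUV.T4Continuum.HistoryJoinsAdm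
open Summit.QuantumFields.BalabanUV.T4Continuum.HistoryAssemblyTerms
open Summit.QuantumFields.BalabanUV.T4Continuum.HistoryAssemblyPedigree
open Summit.QuantumFields.BalabanUV.T4Continuum.HistoryAssemblyMultKey
open Summit.QuantumFields.BalabanUV.T4Continuum.HistoryAssemblyMultLetters
open Summit.QuantumFields.BalabanUV.T4Continuum.HistoryRegionTemplates
open Summit.QuantumFields.BalabanUV.T4Continuum.HistoryJoinsTemplates
open Summit.QuantumFields.BalabanUV.T4Continuum.HistoryJoinsPlacedZone
open Summit.QuantumFields.BalabanUV.T4Continuum.HistoryJoinsPlacedValue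
open Summit.QuantumFields.BalabanUV.T4Continuum.HistoryJoinsPlacedMember
open Summit.QuantumFields.BalabanUV.T4Continuum.HistoryJoinsPlacedTwin
open Summit.QuantumFields.BalabanUV.T4Continuum.HistoryJoinsPlacedMult
open Summit.QuantumFields.BalabanUV.T4Continuum.HistorySiblingEntropyBridge
open Summit.QuantumFields.BalabanUV.T4Continuum.HistoryBankingLE
open Summit.QuantumFields.BalabanUV.T4Continuum.HistoryConstants
open Summit.QuantumFields.BalabanUV.T4Continuum.HistoryCaps
open Summit.QuantumFields.BalabanUV.T4Continuum.HistoryZoneMassLawLevels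
open Summit.QuantumFields.BalabanUV.T4Continuum.HistoryRenewalsCost
open Summit.QuantumFields.BalabanUV.T4Continuum.PlacementSkeleton

namespace Summit.QuantumFields.BalabanUV.T4Continuum.HistoryAssemblyMultInstance

noncomputable section

open scoped Classical

/-! ## §1 Two small letters -/

/-- **THE ROOT IS A BIRTH**: `fat (root G) + 1 ≤ bsum (fat + 1) G`. [folklore] -/
theorem fat_root_add_one_le_bsum : ∀ G : Gen PEv,
    ((G.root.fat : ℕ) : ℝ) + 1 ≤ bsum (fun b => ((b.fat : ℕ) : ℝ) + 1) G
  | Gen.born b j => le_rfl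
  | Gen.renew G e h => fat_root_add_one_le_bsum G
  | Gen.merge X Y e => by
      have hX := fat_root_add_one_le_bsum X
      have hY := fat_root_add_one_le_bsum Y
      have h0X : 0 ≤ bsum (fun b => ((b.fat : ℕ) : ℝ) + 1) X := bsum_nonneg (fun _ => by positivity) X
      have h0Y : 0 ≤ bsum (fun b => ((b.fat : ℕ) : ℝ) + 1) Y := bsum_nonneg (fun _ => by positivity) Y
      show (((if X.rootStep ≤ Y.rootStep then X.root else Y.root).fat : ℕ) : ℝ) + 1 ≤
        bsum (fun b => ((b.fat : ℕ) : ℝ) + 1) X + bsum (fun b => ((b.fat : ℕ) : ℝ) + 1) Y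
      split_ifs <;> linarith

/-- `tcap` is monotone in the class [folklore] -/
theorem tcap_mono (d : ℕ) {f f' : ℕ} (h : f ≤ f') : tcap d f ≤ tcap d f' := by
  unfold tcap; exact Nat.mul_le_mul_left _ (by omega)

/-! ## §2 The display `hdis` of every live component from the distinct, boxed constituents of the realised reading -/

section Hdis

variable {ι α π : Type*} [DecidableEq α] {d L n K₀ : ℕ} {s R : ℕ → ℕ → ℕ} {T : ℕ → Finset ι}
  {ped : ℕ → ι → Pedigree α π} {cellP : ℕ → ι → π → Pt d × Finset (Pt d)} {liveC : ℕ → ι → Finset α}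
  {Zd : ℕ → ι → α → Finset (Pt d)}

/-- the births of a live component's member have classes below the data-defined class cap (leaf-06's `dcapOf`): the
template type `Template d (tcap d (dcapOf …))` holds every birth's template. [folklore] -/
theorem tcap_fat_le_of_mem_pbirths (hRS : ∀ K, K₀ ≤ K → ∀ τ ∈ T K, (ped K τ).RenewDated)
    (cellOf : ℕ → ι → α → (Fin d → ℕ)) {K : ℕ} (hK : K₀ ≤ K) {τ : ι} (hτ : τ ∈ T K) {c : α} (hc : c ∈ liveC K τ)
    {bz : PEv × (Pt d × Finset (Pt d))} (hbz : bz ∈ ((ped K τ).toPGen (cellP K τ) c).pbirths) :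
    tcap d bz.1.fat ≤ tcap d (dcapOf Prod.fst T (memOf ped liveC cellOf) K) := by
  refine tcap_mono d (le_of_lt ?_)
  have hb : bz.1 ∈ births ((ped K τ).gen c) := by
    rw [← (ped K τ).toGen_toPGen (cellP K τ) (hRS K hK τ hτ) c]; exact fst_mem_births_toGen _ hbz
  have he : bz.1 ∈ ((ped K τ).gen c).events := births_subset_events _ hb
  rw [Pedigree.gen, events_gmap, mem_image] at he
  obtain ⟨e, he, hbe⟩ := he
  have hq : (cellOf K τ c, (ped K τ).genT c) ∈ memOf ped liveC cellOf K τ := mem_memOf.2 ⟨c, hc, rfl⟩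
  have := fat_lt_dcapOf Prod.fst T (memOf ped liveC cellOf) hτ hq he
  rw [hbe] at this
  exact this

/-- **T3b's DISPLAY `hdis` FOR EVERY LIVE COMPONENT, TYPED LETTERS, FROM THE STRENGTHENED READING** (leaf-08 gen 4's
`hdis_of_realisesD`): `RealisedDomainsR` + per live component `DisjointJoins` and `BoxedBirths` (levels `levelOf (s K) K`)
⇒ the birth-VALUE multiset is duplicate-free, for ANY template capacity `M K` holding the births' classes. [folklore] -/
theorem hdis_of_domainsR (hL : 0 < L) (hN : ∀ K, 0 < n * L ^ K) {M : ℕ → ℕ} (hM : ∀ K, 1 ≤ M K)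
    (hs : ∀ K, K₀ ≤ K → ∀ t, t < K → s K (t + 1) ≤ s K t) (hdrop : ∀ K, K₀ ≤ K → DropCtl (s K) K)
    (H : RealisedDomainsR L s n K₀ R T ped cellP liveC Zd)
    (hDJ : ∀ K, K₀ ≤ K → ∀ τ ∈ T K, ∀ c ∈ liveC K τ, DisjointJoins ((ped K τ).toPGen (cellP K τ) c))
    (hBB : ∀ K, K₀ ≤ K → ∀ τ ∈ T K, ∀ c ∈ liveC K τ,
      BoxedBirths n L K (levelOf (s K) K) ((ped K τ).toPGen (cellP K τ) c))
    (hMf : ∀ K, K₀ ≤ K → ∀ τ ∈ T K, ∀ c ∈ liveC K τ, ∀ bz ∈ ((ped K τ).toPGen (cellP K τ) c).pbirths,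
      tcap d bz.1.fat ≤ M K)
    {K : ℕ} (hK : K₀ ≤ K) {τ : ι} (hτ : τ ∈ T K) {c : α} (hc : c ∈ liveC K τ) :
    (((ped K τ).toPGen (cellP K τ) c).pbirths.map
      fun bz => (bz.1, valP n L K (hN K) (levelOf (s K) K) (M K) (hM K) bz.1 bz.2)).Nodup := by
  obtain ⟨hre, hpend⟩ := H.real K hK τ hτ c hc
  have hlv : LevelFn K (levelOf (s K) K) := levelFn_levelOf (hs K hK) (hdrop K hK)
  refine hdis_of_realisesD (hN K) (hM K) hL ⟨hre, hDJ K hK τ hτ c hc, hBB K hK τ hτ c hc⟩ (fun b hb => ?_)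
    (hMf K hK τ hτ c hc)
  exact hlv.le_K _ ((step_le_lastStep_of_realises _ _ hre b hb).trans hpend.1)

/-- **… IN THE LETTERS OF RECORD** `(physV …).Nodup` (leaf-05 gen 4's cutoff-free datum; `untypeV` is injective), for
any template capacity `M K` holding the births' classes. [folklore] -/
theorem hdisV_of_domainsR (hL : 0 < L) (hn : 0 < n) {M : ℕ → ℕ} (hM : ∀ K, 1 ≤ M K)
    (hs : ∀ K, K₀ ≤ K → ∀ t, t < K → s K (t + 1) ≤ s K t) (hdrop : ∀ K, K₀ ≤ K → DropCtl (s K) K)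
    (H : RealisedDomainsR L s n K₀ R T ped cellP liveC Zd)
    (hDJ : ∀ K, K₀ ≤ K → ∀ τ ∈ T K, ∀ c ∈ liveC K τ, DisjointJoins ((ped K τ).toPGen (cellP K τ) c))
    (hBB : ∀ K, K₀ ≤ K → ∀ τ ∈ T K, ∀ c ∈ liveC K τ,
      BoxedBirths n L K (levelOf (s K) K) ((ped K τ).toPGen (cellP K τ) c))
    (hMf : ∀ K, K₀ ≤ K → ∀ τ ∈ T K, ∀ c ∈ liveC K τ, ∀ bz ∈ ((ped K τ).toPGen (cellP K τ) c).pbirths,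
      tcap d bz.1.fat ≤ M K)
    {K : ℕ} (hK : K₀ ≤ K) {τ : ι} (hτ : τ ∈ T K) {c : α} (hc : c ∈ liveC K τ) :
    (physV n L hn hL M hM s ped cellP K τ c).Nodup := by
  rw [physV_eq_map]
  refine Multiset.Nodup.map (fun bv bv' h => ?_) (hdis_of_domainsR hL (side_pos hn hL) hM hs hdrop H hDJ hBB hMf hK hτ hc)
  simp only [Prod.mk.injEq] at h
  exact Prod.ext h.1 (untypeV_injective _ _ h.2)

end Hdis

/-! ## §3 Row S6g′'s instance in the socket's letters -/

section Instance

variable {ι α π : Type*} [DecidableEq α] [DecidableEq π] {d n L K₀ : ℕ} {C : T4PrintedShapeBanking.Consts}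
  {s R : ℕ → ℕ → ℕ} {T : ℕ → Finset ι} {ped : ℕ → ι → Pedigree α π} {cellP : ℕ → ι → π → Pt d × Finset (Pt d)}
  {liveC : ℕ → ι → Finset α} {Zd : ℕ → ι → α → Finset (Pt d)}

/-- **ROW S6g′'s INSTANCE IN THE LETTERS OF THE MULTIPLICITY SOCKET** (`hmult` of the END of record v2's twin
`HistoryRealiseCellsRunMult.hybridNE7_of_realisedDomainsRun_printedMult`, at `Λm := L^d` and the displayed allowance
`Ξ K q := 8∕E₂·totalCostT … q.2 + 4·partnerAges … q.2`), for ANY `θ ≥ ΘJ d sS θc + 8·2^d·log(2d+1)` and any template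
capacity `M K` holding the births' classes. [folklore] -/
theorem card_koccOf_le_exp (hn : 0 < n) (hL0 : 0 < L) (hL4 : 4 ≤ L) (hn₁ : 13 ≤ C.n₁) (hE₂ : 0 < C.E₂)
    (hE₃ : 0 ≤ C.E₃) {M : ℕ → ℕ} (hM : ∀ K, 1 ≤ M K)
    (hs : ∀ K, K₀ ≤ K → ∀ t, s K (t + 1) ≤ s K t) (hdrop : ∀ K, K₀ ≤ K → ∀ m, DropCtl (s K) m)
    (hR1 : ∀ K, K₀ ≤ K → ∀ t, 1 ≤ R K t)
    (H : RealisedDomainsR L s n K₀ R T ped cellP liveC Zd)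
    (hstep : ∀ K, K₀ ≤ K → ∀ τ ∈ T K, ∀ c ∈ liveC K τ, (ped K τ).step c ≤ K)
    (hMf : ∀ K, K₀ ≤ K → ∀ τ ∈ T K, ∀ c ∈ liveC K τ, ∀ bz ∈ ((ped K τ).toPGen (cellP K τ) c).pbirths,
      tcap d bz.1.fat ≤ M K)
    (jstar : ℕ → ℕ)
    (hdis : ∀ K, K₀ ≤ K → ∀ τ ∈ badTerms (memOf ped liveC (cellOfR n L s ped cellP)) jstar T K, ∀ c ∈ liveC K τ,
      (physV n L hn hL0 M hM s ped cellP K τ c).Nodup)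
    -- the count's stride and decay, with their arithmetic side conditions (symbolic)
    {sS : ℕ} (hsS : 1 ≤ sS)
    (hsmall : (((2 * cth 32 1 sS + 1) ^ d : ℕ) : ℝ) * (5 : ℝ) ^ d * ((max 1 (2 * 32 + 2) : ℕ) : ℝ) ≤
      (L : ℝ) ^ (sS / 2) / 2)
    {θc : ℝ} (hθc0 : 0 ≤ θc) (hθc1 : θc < 1) (hθcs : 1 / 2 ≤ θc ^ sS)
    {θ : ℝ} (hθ : (2 +
            ((2 * (((2 * cth 32 1 sS + 1) ^ d : ℕ) : ℝ) * ((((2 * 32 + 1) ^ d : ℕ) : ℝ) * (4 * 2 ^ d)) +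
                  4 * ((((2 * cth 32 1 sS + 1) ^ d : ℕ) : ℝ) * (5 : ℝ) ^ d)) / (1 - θc) +
              2 * (2 * ((((2 * cth 32 1 sS + 1) ^ d : ℕ) : ℝ) * (5 : ℝ) ^ d))) +
            (2 * ((0 + 2 * Real.log (2 * d + 1)) + (2 * (d : ℝ) + 2 * Real.log (2 * d + 1)) *
                  (((max 1 (2 * 32 + 2) : ℕ) : ℝ) * (2 * ((((2 * cth 32 1 sS + 1) ^ d : ℕ) : ℝ) * (5 : ℝ) ^ d)))) +
              (2 * (d : ℝ) + 2 * Real.log (2 * d + 1)) * 1 *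
                (((max 1 (2 * 32 + 2) : ℕ) : ℝ) *
                    ((2 * (((2 * cth 32 1 sS + 1) ^ d : ℕ) : ℝ) * ((((2 * 32 + 1) ^ d : ℕ) : ℝ) * (4 * 2 ^ d)) +
                        4 * ((((2 * cth 32 1 sS + 1) ^ d : ℕ) : ℝ) * (5 : ℝ) ^ d)) / (1 - θc)) +
                  4 * 2 ^ d)) +
            10) + 8 * 2 ^ d * Real.log (2 * d + 1) ≤ θ)
    {K : ℕ} (hK : K₀ ≤ K) {τ : ι} (hτ : τ ∈ badTerms (memOf ped liveC (cellOfR n L s ped cellP)) jstar T K)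
    {c : α} (hc : c ∈ liveC K τ) :
    ((koccOf ped liveC (cellOfR n L s ped cellP) (physV n L hn hL0 M hM s ped cellP) jstar T K
        (kslot (keyOf ped (cellOfR n L s ped cellP) (physV n L hn hL0 M hM s ped cellP) K τ c))).card : ℝ) ≤
      Real.exp (θ * birthLinT Prod.fst ((ped K τ).genT c) +
          (8 / C.E₂ * totalCostT Prod.fst C K (R K) ((ped K τ).genT c) +
            4 * (partnerAges (PEv.step ∘ Prod.fst) ((ped K τ).genT c) : ℝ))) *
        ((L : ℝ) ^ d) ^ partnerAges (PEv.step ∘ Prod.fst) ((ped K τ).genT c) := by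
  -- letters
  have hL1 : 1 ≤ L := hL0
  have hL3 : 3 ≤ L := le_trans (by norm_num) hL4
  have hτT : τ ∈ T K := (mem_badTerms.1 hτ).1
  have hlv : LevelFn K (levelOf (s K) K) := levelFn_levelOf (fun t _ => hs K hK t) (hdrop K hK K)
  -- the reading's fields at this run
  have hH : ∀ τ ∈ T K, ∀ c, (ped K τ).HeadOldest c := fun τ hτ => H.headOldest K hK τ hτ
  have hRS : ∀ τ ∈ T K, (ped K τ).RenewDated := fun τ hτ => H.renew_step K hK τ hτ
  have hreal : ∀ τ ∈ T K, ∀ c ∈ liveC K τ, ∃ Z, Realises L (s K) (R K) ((ped K τ).toPGen (cellP K τ) c) Z ∧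
      ((ped K τ).toPGen (cellP K τ) c).lastStep ≤ K :=
    fun τ hτ c hc => ⟨Zd K τ c, (H.real K hK τ hτ c hc).1, (H.real K hK τ hτ c hc).2.1⟩
  -- the auxiliary count data: depth, junk value, tie-break order (the bound does not depend on them)
  have hD : ∀ a ∈ baddr ((ped K τ).sortR.gen c), a.length ≤ (baddr ((ped K τ).sortR.gen c)).sup List.length :=
    fun a ha => Finset.le_sup (f := List.length) ha
  let c₀ : TCell d (n * L ^ K) × Template d (M K) := (fun _ => ⟨0, side_pos hn hL0 K⟩, Template.zero (hM K))
  let ρ : (Addr ((baddr ((ped K τ).sortR.gen c)).sup List.length) → TCell d (n * L ^ K) × Template d (M K)) → ℕ :=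
    fun f => (Fintype.equivFin _ f : ℕ)
  have hρ : Function.Injective ρ := fun f f' h => (Fintype.equivFin _).injective (Fin.ext h)
  -- the twin END, uniformly in the root datum
  obtain ⟨hre, hpend⟩ := H.real K hK τ hτT c hc
  have hcons : ConsistentTLE Prod.fst C K (R K) ((ped K τ).genT c) :=
    consistentTLE_genT_of_realises hL4 (hdrop K hK) (hR1 K hK) C hn₁ (ped K τ) (cellP K τ)
      (H.renew_step K hK τ hτT) hre hpend.1
  have hφ : ∀ m, m ≤ K → C.E₂ ≤ floorK C K (R K) m := fun m hm => by
    simpa using le_floorK_of_le (C := C) (K := K) (R := R K) hE₂.le hm (hR1 K hK m)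
  have htwin : ∀ z, ((S (zoneP n L K (levelOf (s K) K) 32 c₀) ρ c₀ PEv.step ((ped K τ).sortR.gen c) z).card : ℝ) ≤
      Real.exp ((2 +
            ((2 * (((2 * cth 32 1 sS + 1) ^ d : ℕ) : ℝ) * ((((2 * 32 + 1) ^ d : ℕ) : ℝ) * (4 * 2 ^ d)) +
                  4 * ((((2 * cth 32 1 sS + 1) ^ d : ℕ) : ℝ) * (5 : ℝ) ^ d)) / (1 - θc) +
              2 * (2 * ((((2 * cth 32 1 sS + 1) ^ d : ℕ) : ℝ) * (5 : ℝ) ^ d))) +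
            (2 * ((0 + 2 * Real.log (2 * d + 1)) + (2 * (d : ℝ) + 2 * Real.log (2 * d + 1)) *
                  (((max 1 (2 * 32 + 2) : ℕ) : ℝ) * (2 * ((((2 * cth 32 1 sS + 1) ^ d : ℕ) : ℝ) * (5 : ℝ) ^ d)))) +
              (2 * (d : ℝ) + 2 * Real.log (2 * d + 1)) * 1 *
                (((max 1 (2 * 32 + 2) : ℕ) : ℝ) *
                    ((2 * (((2 * cth 32 1 sS + 1) ^ d : ℕ) : ℝ) * ((((2 * 32 + 1) ^ d : ℕ) : ℝ) * (4 * 2 ^ d)) +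
                        4 * ((((2 * cth 32 1 sS + 1) ^ d : ℕ) : ℝ) * (5 : ℝ) ^ d)) / (1 - θc)) +
                  4 * 2 ^ d)) +
            10) * bsum (fun b => ((b.fat : ℕ) : ℝ) + 1) ((ped K τ).gen c) +
          8 / C.E₂ * totalCostT Prod.fst C K (R K) ((ped K τ).genT c)) *
        (((L : ℝ) ^ d) * Real.exp 4) ^ partnerAges PEv.step ((ped K τ).gen c) :=
    fun z => card_S_sortR_le_exp_pow (ped K τ) ρ (H.headOldest K hK τ hτT) (H.renew_step K hK τ hτT)
      (H.forest K hK τ hτT) hE₂.le hE₃ hE₂ hφ c hcons (hstep K hK τ hτT c hc) hL1 hn hlv hsS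
      (fun u _ => levelFn_add_half_le hlv u sS) hsmall hθc0 hθc1 hθcs z
  -- the largest counted set over the root data realises the uniform natural bound
  obtain ⟨z₀, -, hz₀⟩ := Finset.exists_mem_eq_sup (univ : Finset (TCell d (n * L ^ K) × Template d (M K)))
    ⟨c₀, mem_univ _⟩ (fun z => (S (zoneP n L K (levelOf (s K) K) 32 c₀) ρ c₀ PEv.step ((ped K τ).sortR.gen c) z).card)
  have hB : ∀ z, (S (zoneP n L K (levelOf (s K) K) 32 c₀) ρ c₀ PEv.step ((ped K τ).sortR.gen c) z).card ≤
      (univ : Finset (TCell d (n * L ^ K) × Template d (M K))).sup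
        (fun z => (S (zoneP n L K (levelOf (s K) K) 32 c₀) ρ c₀ PEv.step ((ped K τ).sortR.gen c) z).card) :=
    fun z => Finset.le_sup (f := fun z =>
      (S (zoneP n L K (levelOf (s K) K) 32 c₀) ρ c₀ PEv.step ((ped K τ).sortR.gen c) z).card) (mem_univ z)
  -- the image count
  have hcount := card_koccOf_le hn hL3 M hM s ped cellP liveC jstar T R c₀ ρ hL0 hρ (hs K hK) (hdrop K hK) hH hRS
    hreal (H.inBox K hK) (hstep K hK) (hMf K hK) (hdis K hK) hτT c hD hB
  rw [hz₀] at hcount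
  have hA0 : (0 : ℝ) < A d (M K) (tcap d ((ped K τ).sortR.gen c).root.fat) := by
    exact_mod_cast one_le_A (hM K) (one_le_tcap d _)
  have hreal_count : ((koccOf ped liveC (cellOfR n L s ped cellP) (physV n L hn hL0 M hM s ped cellP) jstar T K
      (kslot (keyOf ped (cellOfR n L s ped cellP) (physV n L hn hL0 M hM s ped cellP) K τ c))).card : ℝ) ≤
      (A d (M K) (tcap d ((ped K τ).sortR.gen c).root.fat) : ℝ) *
        (Real.exp ((2 +
            ((2 * (((2 * cth 32 1 sS + 1) ^ d : ℕ) : ℝ) * ((((2 * 32 + 1) ^ d : ℕ) : ℝ) * (4 * 2 ^ d)) +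
                  4 * ((((2 * cth 32 1 sS + 1) ^ d : ℕ) : ℝ) * (5 : ℝ) ^ d)) / (1 - θc) +
              2 * (2 * ((((2 * cth 32 1 sS + 1) ^ d : ℕ) : ℝ) * (5 : ℝ) ^ d))) +
            (2 * ((0 + 2 * Real.log (2 * d + 1)) + (2 * (d : ℝ) + 2 * Real.log (2 * d + 1)) *
                  (((max 1 (2 * 32 + 2) : ℕ) : ℝ) * (2 * ((((2 * cth 32 1 sS + 1) ^ d : ℕ) : ℝ) * (5 : ℝ) ^ d)))) +
              (2 * (d : ℝ) + 2 * Real.log (2 * d + 1)) * 1 *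
                (((max 1 (2 * 32 + 2) : ℕ) : ℝ) *
                    ((2 * (((2 * cth 32 1 sS + 1) ^ d : ℕ) : ℝ) * ((((2 * 32 + 1) ^ d : ℕ) : ℝ) * (4 * 2 ^ d)) +
                        4 * ((((2 * cth 32 1 sS + 1) ^ d : ℕ) : ℝ) * (5 : ℝ) ^ d)) / (1 - θc)) +
                  4 * 2 ^ d)) +
            10) * bsum (fun b => ((b.fat : ℕ) : ℝ) + 1) ((ped K τ).gen c) +
            8 / C.E₂ * totalCostT Prod.fst C K (R K) ((ped K τ).genT c)) *
          (((L : ℝ) ^ d) * Real.exp 4) ^ partnerAges PEv.step ((ped K τ).gen c)) := by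
    have h1 : ((koccOf ped liveC (cellOfR n L s ped cellP) (physV n L hn hL0 M hM s ped cellP) jstar T K
        (kslot (keyOf ped (cellOfR n L s ped cellP) (physV n L hn hL0 M hM s ped cellP) K τ c))).card : ℝ) ≤
        (A d (M K) (tcap d ((ped K τ).sortR.gen c).root.fat) : ℝ) *
          ((S (zoneP n L K (levelOf (s K) K) 32 c₀) ρ c₀ PEv.step ((ped K τ).sortR.gen c) z₀).card : ℝ) := by
      exact_mod_cast hcount
    exact h1.trans (mul_le_mul_of_nonneg_left (htwin z₀) hA0.le)
  -- the letters: `bsum = birthLinT`, `partnerAges` through the tag-forgetting map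
  rw [← birthLinT_genT (ped K τ) (H.forest K hK τ hτT) c hcons, partnerAges_gen (ped K τ) c] at hreal_count
  -- repackaging: the template factor and `e^4` per partner-age unit join the exponent
  have hpack := le_exp_mul_pow_of_twin hA0 hreal_count
  refine hpack.trans (mul_le_mul_of_nonneg_right (Real.exp_le_exp.2 ?_) (pow_nonneg (pow_nonneg (Nat.cast_nonneg _) _) _))
  -- the template factor is class-linear: `log A ≤ 8·2^d·log(2d+1)·birthLinT`
  have hlog0 : 0 ≤ Real.log (2 * (d : ℝ) + 1) := Real.log_nonneg (by norm_cast; omega)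
  have hbL : ((((ped K τ).sortR.gen c).root.fat : ℕ) : ℝ) + 1 ≤ birthLinT Prod.fst ((ped K τ).genT c) := by
    rw [birthLinT_genT (ped K τ) (H.forest K hK τ hτT) c hcons, ← bsum_gen_sortR (ped K τ) _ (H.headOldest K hK τ hτT) c]
    exact fat_root_add_one_le_bsum _
  have hbL0 : 0 ≤ birthLinT Prod.fst ((ped K τ).genT c) := le_trans (by positivity) hbL
  have hlogA : Real.log (A d (M K) (tcap d ((ped K τ).sortR.gen c).root.fat) : ℝ) ≤
      8 * 2 ^ d * Real.log (2 * d + 1) * birthLinT Prod.fst ((ped K τ).genT c) := by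
    have h1 : Real.log (A d (M K) (tcap d ((ped K τ).sortR.gen c).root.fat) : ℝ) ≤
        2 * Real.log (2 * d + 1) * (tcap d ((ped K τ).sortR.gen c).root.fat : ℕ) :=
      (Real.log_le_iff_le_exp hA0).2 (A_le_exp d (M K) _)
    have h2 : ((tcap d ((ped K τ).sortR.gen c).root.fat : ℕ) : ℝ) ≤
        4 * 2 ^ d * (((((ped K τ).sortR.gen c).root.fat : ℕ) : ℝ) + 1) := tcap_le_real d _
    have h3 : ((tcap d ((ped K τ).sortR.gen c).root.fat : ℕ) : ℝ) ≤
        4 * 2 ^ d * birthLinT Prod.fst ((ped K τ).genT c) :=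
      h2.trans (mul_le_mul_of_nonneg_left hbL (by positivity))
    calc _ ≤ 2 * Real.log (2 * d + 1) * (tcap d ((ped K τ).sortR.gen c).root.fat : ℕ) := h1
      _ ≤ 2 * Real.log (2 * d + 1) * (4 * 2 ^ d * birthLinT Prod.fst ((ped K τ).genT c)) :=
          mul_le_mul_of_nonneg_left h3 (by positivity)
      _ = _ := by ring
  have hθb := mul_le_mul_of_nonneg_right hθ hbL0
  nlinarith [hlogA, hθb, hbL0, hlog0]

end Instance

end

end Summit.QuantumFields.BalabanUV.T4Continuum.HistoryAssemblyMultInstance
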